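import Summits.BirchSwinnertonDyer.BirchSwinnertonDyer.Theorems.PrintCf2SplitBadTwoKummerProNullDischarge
import HarnessLib

/-!
# Crux `PrintCf2.SplitBadTwoRankOneOfFacts` (stmt-BirchSwinnertonDyer-20368), S3n′-FACT-FREE road:
# (SUR) AT A FINITE LAYER, θ = 1, Γ_F-currency — the level-lifting surgery with its (PRO-NULL) input DISCHARGED

Cell `bsd-print-cf2`, WIDTH seat `bsd-line-cf2-p1-w7` g6 (prover-bsd-line-cf2-p1-w7-g6-0); `--supports
stmt-BirchSwinnertonDyer-20368` (helper, Theses-free). HONEST FRAMING: nothing here closes the crux or a registered stub;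
BSD is not proved by any of this; no summit statement is proved by this seat. No definition, no named fact, no `sorry`.
UNCONDITIONAL: Poitou–Tate for Selmer structures (`selmerComplement_canonical_holds`) + (PRO-NULL) for the trivial cyclic levels
(`KummerProNull.proNull_canonical_of_trivial`, p701967 ⟸ R1 = Leopoldt/Brumer, p696581) — no named fact anywhere.

WHAT (memos `Cruxes/SplitBadTwoRankOneOfFacts/S3N-FACTFREE-w2g14.md` §2 (SUR*_n) and `R2-BRICKS-w5g7.md` §1/§3, road (a) =
«Poitou–Tate over the layer `F = K*_n` as a number field»). `-w5` g7's engine `ProNullLift.exists_selmer_sub_localMap_mem_canonical_of_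
dualPullback_eq_zero` (p700098) with its one input `hkill` supplied by `proNull_canonical_of_trivial` (p701967):

* **`exists_selmer_sub_localMap_mem_of_trivial`** — `K` imaginary quadratic, `p = v v̄` split, `F/K` finite ABELIAN; `∀ k ∃ M ≥ k`
  such that for all trivial discrete `Γ_F`-modules `ρ₀` on `ℤ/p^k`, `ρ` on `ℤ/p^M`, every `ι` with `ι(1) = p^{M−k}`, the Selmer
  structure `𝓕 = ⊤` above `v` / `H¹_ur` at every other finite place, ANY finite set of places `S ⊇ {w ∣ p} ∪ {w ∣ ∞}`, ANY `𝓖 ≥ 𝓕`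
  unramified outside `S`, and ANY family of level-`k` local classes `s_w` with `H¹(ι_w) s_w ∈ 𝓖_w` (`w ∈ S`):
  **`∃ x ∈ H¹_𝓖(F, ℤ/p^M), ∀ w ∈ S, loc_w x − H¹(ι_w) s_w ∈ 𝓕_w`** — every family of LEVEL-`k` local classes is realised, modulo
  the unramified classes (modulo nothing above `v`), by a global class of LEVEL `M` with the prescribed ramification: the finite-layer
  surjectivity (SUR_n) of the fact-free road, for `θ = 1`, in the currency of the layer field.
* `exists_selmer_sub_localMap_mem_single_of_trivial` — one target place at a time (family supported at `w₀`).
What it is for: the U-currency consumers ((LS↑) of `-w4` g12 `UpperBaseLift.locSurj_of_layers`, targets on `κ₂.layerSubgroup n`)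
receive it through the local-groups bridge Γ_F → Γ_K of `-w6` g6 (`LocalGroupsBridge`, announced 06:20:42Z: `galFixing K L ⊓ σ·D_u·σ⁻¹ =
(decomp w).map res`); coefficient passage to the divisible `A` is `-w4` g12's B3. beyond-print theorem: no. presearch: NOTES.md.

References: J. S. Milne, *Arithmetic Duality Theorems* (2006), I Thm. 4.10; B. Howard, Compos. Math. 140 (2004), Thm. 2.1.11;
R. Greenberg, Kyoto J. Math. 50 (2010), Prop. 3.2.1; R. Greenberg, LNM 1716 (1999), Props. 4.13–4.15.
-/

noncomputable section

set_option linter.dupNamespace false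
set_option autoImplicit false

open scoped Classical ContRepresentation
open NumberField IsDedekindDomain Field
open Literature.NumberTheory.GaloisRepresentations
open Literature.NumberTheory.GaloisRepresentations.DiscreteGaloisModule
open Literature.NumberTheory.GaloisCohomology
open Literature.NumberTheory.EllipticCurves (IsImaginaryQuadratic)
open Summit.BirchSwinnertonDyer.Rank1Residual.GaloisImage.Transport (tateDualComap)

namespace Summit.BirchSwinnertonDyer.BirchSwinnertonDyer.Theorems.PrintCf2.KummerProNull

variable {K : Type} [Field K] [NumberField K] {p : ℕ} [hp : Fact p.Prime]

/-- **(SUR_n), θ = 1, Γ_F-currency: the level-lifting surgery with its (PRO-NULL) input discharged.** Let `K` be imaginary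
quadratic, `p = v v̄` split, `F/K` finite abelian. For every `k` there is `M ≥ k` such that for all trivial discrete
`Γ_F`-modules `ρ₀` on `ℤ/p^k` and `ρ` on `ℤ/p^M`, every `ι : ρ₀ → ρ` with `ι(1) = p^{M−k}`, the Selmer structure `𝓕` which is `⊤`
above `v` and `H¹_ur` at the other finite places, every finite set of places `S` containing the places above `p` and the infinite
places, every `𝓖 ≥ 𝓕` unramified outside `S`, and every family `s_w ∈ H¹(F_w, ℤ/p^k)` with `H¹(ι_w) s_w ∈ 𝓖_w` (`w ∈ S`), there is
`x ∈ H¹_𝓖(F, ℤ/p^M)` with `loc_w x − H¹(ι_w) s_w ∈ 𝓕_w` for all `w ∈ S`. (= `ProNullLift.exists_selmer_sub_localMap_mem_canonical_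
of_dualPullback_eq_zero` ∘ `proNull_canonical_of_trivial`.) [cite: MilneADT2006, Ch. I, Thm. 4.10 (b)]
[cite: Howard2004HeegnerKolyvagin, Thm. 2.1.11 (arXiv:1202.6340 p. 6)] [cite: Greenberg2010, Prop. 3.2.1 (p. 15)] -/
theorem exists_selmer_sub_localMap_mem_of_trivial (hK : IsImaginaryQuadratic K) {v vbar : HeightOneSpectrum (𝓞 K)}
    (hv : ((p : ℕ) : 𝓞 K) ∈ v.asIdeal) (hvbar : ((p : ℕ) : 𝓞 K) ∈ vbar.asIdeal) (hne : vbar ≠ v)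
    (F : IntermediateField K (AlgebraicClosure K)) [FiniteDimensional K F] [IsAbelianGalois K F] [NumberField F] (k : ℕ) :
    ∃ M : ℕ, k ≤ M ∧ ∀ (ρ₀ : DiscreteGaloisModule F (ZMod (p ^ k))) (ρ : DiscreteGaloisModule F (ZMod (p ^ M)))
      (_hρ₀ : ∀ (σ : absoluteGaloisGroup F) (m : ZMod (p ^ k)), ρ₀ σ m = m)
      (_hρ : ∀ (σ : absoluteGaloisGroup F) (m : ZMod (p ^ M)), ρ σ m = m)
      (ι : ρ₀.toContRepresentation →ⁱL ρ.toContRepresentation) (_hι : ι 1 = ((p ^ (M - k) : ℕ) : ZMod (p ^ M)))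
      (𝓕 : SelmerStructure ρ)
      (_h𝓕v : ∀ w : HeightOneSpectrum (𝓞 F), w.under (𝓞 K) = v → 𝓕 (Sum.inr w) = ⊤)
      (_h𝓕 : ∀ w : HeightOneSpectrum (𝓞 F), w.under (𝓞 K) ≠ v →
        𝓕 (Sum.inr w) = unramifiedSubgroup (GaloisRep.toLocal w ρ) 1)
      (S : Finset (Place F))
      (_hSp : ∀ w : HeightOneSpectrum (𝓞 F), ((p : ℕ) : 𝓞 F) ∈ w.asIdeal → (Sum.inr w : Place F) ∈ S)
      (_hS : ∀ w : InfinitePlace F, (Sum.inl w : Place F) ∈ S)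
      (𝓖 : SelmerStructure ρ) (_hle : 𝓕 ≤ 𝓖) (_h𝓖 : 𝓖.IsUnramifiedOutside S)
      (s : Π w : Place F, galoisCohomology (ρ₀.toLocal w) 1) (_hs : ∀ w ∈ S, localMap ι w (s w) ∈ 𝓖 w),
      ∃ x ∈ 𝓖.selmerGroup, ∀ w ∈ S, galoisCohomology.localization ρ w 1 x - localMap ι w (s w) ∈ 𝓕 w := by
  obtain ⟨M, hkM, hM⟩ := proNull_canonical_of_trivial (p := p) hK hv hvbar hne F k
  refine ⟨M, hkM, fun ρ₀ ρ hρ₀ hρ ι hι 𝓕 h𝓕v h𝓕 S hSp hSinf 𝓖 hle h𝓖 s hs ↦ ?_⟩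
  haveI : NeZero (p ^ M) := ⟨pow_ne_zero M hp.out.ne_zero⟩
  -- `p^M` kills `ℤ/p^M`
  have hMod : ∀ m : ZMod (p ^ M), (p ^ M) • m = 0 := fun m ↦ by
    rw [nsmul_eq_mul, ZMod.natCast_self, zero_mul]
  -- places outside `S`: `p^M` is a unit there and `ρ` (trivial) is unramified
  have hSout : ∀ w : HeightOneSpectrum (𝓞 F), (Sum.inr w : Place F) ∉ S →
      ((p ^ M : ℕ) : 𝓞 F) ∉ w.asIdeal ∧ GaloisRep.IsUnramifiedAt w ρ := fun w hw ↦ by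
    refine ⟨fun h ↦ hw (hSp w ?_), fun _ _ σ _ ↦ LinearMap.ext fun m ↦ hρ σ m⟩
    rw [Nat.cast_pow] at h
    exact w.isPrime.mem_of_pow_mem M h
  -- `𝓕` is unramified outside `S` (the places above `v` lie in `S`)
  have h𝓕S : 𝓕.IsUnramifiedOutside S := by
    refine ⟨hSinf, fun w hw ↦ h𝓕 w fun hwv ↦ hw (hSp w ?_)⟩
    have h1 : ((p : ℕ) : 𝓞 K) ∈ (w.under (𝓞 K)).asIdeal := hwv ▸ hv
    rw [HeightOneSpectrum.under_asIdeal, Ideal.under_def, Ideal.mem_comap, map_natCast] at h1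
    exact h1
  exact ProNullLift.exists_selmer_sub_localMap_mem_canonical_of_dualPullback_eq_zero ρ₀ ρ (p ^ M) ι hMod S hSout hle
    h𝓕S h𝓖 s hs (hM ρ₀ ρ hρ₀ hρ ι hι 𝓕 h𝓕v h𝓕)

/-- **(SUR_n) one place at a time.** Same setting; for `w₀ ∈ S` and a level-`k` class `g ∈ H¹(F_{w₀}, ℤ/p^k)` with `H¹(ι) g ∈
𝓖_{w₀}` there is `x ∈ H¹_𝓖(F, ℤ/p^M)` with `loc_{w₀} x − H¹(ι) g ∈ 𝓕_{w₀}` and `loc_w x ∈ 𝓕_w` at the other `w ∈ S`.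
[cite: Howard2004HeegnerKolyvagin, Thm. 2.1.11 (arXiv:1202.6340 p. 6)] [cite: MilneADT2006, Ch. I, Thm. 4.10 (b)] -/
theorem exists_selmer_sub_localMap_mem_single_of_trivial (hK : IsImaginaryQuadratic K) {v vbar : HeightOneSpectrum (𝓞 K)}
    (hv : ((p : ℕ) : 𝓞 K) ∈ v.asIdeal) (hvbar : ((p : ℕ) : 𝓞 K) ∈ vbar.asIdeal) (hne : vbar ≠ v)
    (F : IntermediateField K (AlgebraicClosure K)) [FiniteDimensional K F] [IsAbelianGalois K F] [NumberField F] (k : ℕ) :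
    ∃ M : ℕ, k ≤ M ∧ ∀ (ρ₀ : DiscreteGaloisModule F (ZMod (p ^ k))) (ρ : DiscreteGaloisModule F (ZMod (p ^ M)))
      (_hρ₀ : ∀ (σ : absoluteGaloisGroup F) (m : ZMod (p ^ k)), ρ₀ σ m = m)
      (_hρ : ∀ (σ : absoluteGaloisGroup F) (m : ZMod (p ^ M)), ρ σ m = m)
      (ι : ρ₀.toContRepresentation →ⁱL ρ.toContRepresentation) (_hι : ι 1 = ((p ^ (M - k) : ℕ) : ZMod (p ^ M)))
      (𝓕 : SelmerStructure ρ)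
      (_h𝓕v : ∀ w : HeightOneSpectrum (𝓞 F), w.under (𝓞 K) = v → 𝓕 (Sum.inr w) = ⊤)
      (_h𝓕 : ∀ w : HeightOneSpectrum (𝓞 F), w.under (𝓞 K) ≠ v →
        𝓕 (Sum.inr w) = unramifiedSubgroup (GaloisRep.toLocal w ρ) 1)
      (S : Finset (Place F))
      (_hSp : ∀ w : HeightOneSpectrum (𝓞 F), ((p : ℕ) : 𝓞 F) ∈ w.asIdeal → (Sum.inr w : Place F) ∈ S)
      (_hS : ∀ w : InfinitePlace F, (Sum.inl w : Place F) ∈ S)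
      (𝓖 : SelmerStructure ρ) (_hle : 𝓕 ≤ 𝓖) (_h𝓖 : 𝓖.IsUnramifiedOutside S)
      {w₀ : Place F} (_hw₀ : w₀ ∈ S) (g : galoisCohomology (ρ₀.toLocal w₀) 1) (_hg : localMap ι w₀ g ∈ 𝓖 w₀),
      ∃ x ∈ 𝓖.selmerGroup, galoisCohomology.localization ρ w₀ 1 x - localMap ι w₀ g ∈ 𝓕 w₀ ∧
        ∀ w ∈ S, w ≠ w₀ → galoisCohomology.localization ρ w 1 x ∈ 𝓕 w := by
  obtain ⟨M, hkM, hM⟩ := exists_selmer_sub_localMap_mem_of_trivial (p := p) hK hv hvbar hne F k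
  refine ⟨M, hkM, fun ρ₀ ρ hρ₀ hρ ι hι 𝓕 h𝓕v h𝓕 S hSp hSinf 𝓖 hle h𝓖 w₀ hw₀ g hg ↦ ?_⟩
  -- the family supported at `w₀`
  let s : Π w : Place F, galoisCohomology (ρ₀.toLocal w) 1 := fun w ↦ if h : w = w₀ then h ▸ g else 0
  have hs₀ : s w₀ = g := dif_pos rfl
  have hsne : ∀ w, w ≠ w₀ → s w = 0 := fun w hw ↦ dif_neg hw
  have hs : ∀ w ∈ S, localMap ι w (s w) ∈ 𝓖 w := fun w _ ↦ by
    by_cases hw : w = w₀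
    · subst hw; rw [hs₀]; exact hg
    · rw [hsne w hw, map_zero]; exact zero_mem _
  obtain ⟨x, hx, hxS⟩ := hM ρ₀ ρ hρ₀ hρ ι hι 𝓕 h𝓕v h𝓕 S hSp hSinf 𝓖 hle h𝓖 s hs
  refine ⟨x, hx, ?_, fun w hw hne' ↦ ?_⟩
  · have h := hxS w₀ hw₀
    rwa [hs₀] at h
  · have h := hxS w hw
    rwa [hsne w hne', map_zero, sub_zero] at h

end Summit.BirchSwinnertonDyer.BirchSwinnertonDyer.Theorems.PrintCf2.KummerProNull

end
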